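import Literature.NumberTheory.Automorphic.Liu2021.AppendixC.DefC1toC3                  -- ★ `HermSpace` (`sig`, `form`, `Gfin`), `conj`
import Literature.AlgebraicGeometry.AbelianSchemes.AbelianSchemeOverRingAction            -- ★ `AbelianSchemeOver.RingAction (𝓞 k)`
import Literature.AlgebraicGeometry.AbelianSchemes.AbelianSchemePolarizationBaseChange     -- ★ `DualPair`, `Polarization` (+ `baseChange`)
import Literature.AlgebraicGeometry.AbelianSchemes.AbelianSchemeFixedPowBaseChange         -- ★ `RingAction.baseChange`
import Mathlib.NumberTheory.NumberField.Discriminant.Defs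
import Mathlib.NumberTheory.Padics.PadicVal.Basic
import HarnessLib

/-!
# Kudla–Rapoport, *Special cycles on unitary Shimura varieties II: global theory* — §2 «The global moduli problem»:
# VOCABULARY AND OBJECTS (`Sec2Defs`) — the datum `Sec2Core k` / `Sec2Data C`, the objects of `M(n−r,r)^naive(S)`, `M(n−r,r)(S)`,
# `M₀(S)`, `M(S)`, `Z(T)(S)`, self-dual lattices, relevant hermitian spaces `R_{(n−r,r)}(k)`, `R^♯` (arXiv 0912.3758 **v2** pp. 7–15)

[KudlaRapoport2013] = S. Kudla, M. Rapoport, *Special cycles on unitary Shimura varieties II: global theory*, J. reine angew.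
Math. **697** (2014) 91–157, doi 10.1515/crelle-2012-0121 = arXiv:0912.3758.  SOURCE OF RECORD: arXiv **v2** («last revised 18 Dec
2012», 60 pp., the version of record — Rapoport–Smithling–Zhang cite the Crelle numbering «[31, §2.3]», «[31, Rem. 4.2]», which is
v2's), extracted page by page into the squad kit `T/KR/TKR-t01/g0/KR2013-arxiv-v2-pages.TKR-t01-g0.txt` (sha16 cab423ad46aa69e3; «p. N»
below = arXiv v2 page N = the running-head page); symbols re-read on the held TeX text `paper:arxiv-0912.3758` (arXiv v1, chunks
p0006–p0010), whose §2 STATEMENTS agree with v2 word for word.  NUMBERING = v2 = print (the tree's older §2 tags use v1 numbers: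
v1 has an extra Remark 2.2, so v1 item 2.k = v2 item 2.(k−1) for k ≥ 3; full concordance in the sibling `Sec2GlobalModuliProblem`).

## What this file is (squad TKR, seat TKR-t01, deal sheet `SPLIT-TKR.v1` row t01; companion of `Sec2GlobalModuliProblem`)

The VOCABULARY of §2 in the discipline of the sibling carpets (`RapoportSmithlingZhang2020.Sec3IntegralModels`, same field shapes
so that §4 / RSZ consumers can bridge); the numbered Lemmas / Propositions / Theorems are typed over it in `Sec2GlobalModuliProblem`.
A datum in TWO PARTS: `structure Sec2Core k` carries the REAL numerics «an integer `n ≥ 1` and a decomposition `n = (n−r) + r`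
with `0 ≤ r ≤ n`» and the ⟨CARRIER⟩ clause predicates / functions Mathlib and the tree cannot evaluate on a general base — the
signature = Kottwitz condition (2.1) and the wedge condition (2.2) on `Lie A`, the Rosati condition, pull-back of polarizations
(with ⟨CARRIER LAW⟩s of stability under base change, used only to base-change OBJECTS), the hermitian form `h'` (2.4) (REAL
codomain `O_k`), the Tate-module forms of §2.3, genera / local orbits / local invariants of hermitian lattices and spaces,
«supersingular», and the six STACK-LEVEL SENTENCES of Prop. 2.1 / Rem. 2.3 / Thm. 2.5 / Prop. 2.9 recorded as `Prop` TOKENS in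
`StackSentences` (Deligne–Mumford stacks, smoothness / flatness of stacks have no vocabulary in Mathlib or the tree) — every
carrier TOTAL with an inhabited codomain chosen by the consumer, so junk values exist off the moduli problems; and `structure
Sec2Data (C : Sec2Core k)` carries the OBJECT-DEPENDENT labels `V(ξ)`, `Hom_k(V(ξ₀), V(ξ))` of the proof of Prop. 2.12 (defined on
objects only, inhabited codomains `R^♯` / ★ `HermSpace ℚ k`).  Over `Sec2Core`, the OBJECTS of the moduli problems are REAL
structures (★ `AbelianSchemeOver S`, ★ `RingAction (𝓞 k)`, ★ `DualPair` / `Polarization`, principal = `IsIso λ`) over an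
`O_k`-scheme `f : S → Spec O_k`, with REAL isomorphism relations and REAL base change; hermitian spaces over `k` are the tree's ★
`Liu2021.AppendixC.HermSpace ℚ k` (REAL `form`, `sig`; `conj ℚ k` = `σ`); self-dual `O_k`-lattices, relevance, isometry, strict
similarity, type I/II, `δ`, `Diff₀(T)`, inert/ramified primes, `T ∈ Herm_m(O_k)_{>0}` are REAL definitions.  NOTHING IS ASSERTED,
nothing is proved; no instance, no notation.

CITED, NOT RESTATED (dedup): the signature FUNCTION of (2.1) and its reflex field — ★
`Literature.NumberTheory.ComplexMultiplication.KudlaRapoportSignatureReflexField` and siblings `KottwitzSignatureReflexField{Degree,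
RationalOrCM}`, `CMTypeSubfieldTracesReflexField{Degree,RationalOrCM}`, `KottwitzDeterminantPolynomialIntegrality` (the right side of
(2.1) lies in `O_k[T]`), `AlgebraicGeometry/ComplexMultiplication/EndomorphismField*` (Lie-algebra signature of an `O_k`-action; the
conjugation twist); the chart-free characteristic polynomial of `ι(a)` on `Lie A` over a LOCAL affine base is ★
`AbelianSchemeOver.lieCharpoly` (`AbelianSchemes/AbelianSchemeCotangentCharpoly`), by which a consumer EVALUATES the ⟨CARRIER⟩
`IsSignature` locally; hermitian spaces ★ `HermSpace` (not re-declared).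

## Contents (item ↦ declaration; v2 pages)
standing data: `σ` ↦ `sigmaInt`, `δ` ↦ `numRamifiedPrimes`, inert / ramified ↦ `IsInertPrime` / `IsRamifiedPrime`, `Herm_m(O_k)_{>0}` ↦
`IsPosDefHerm`, `Diff₀(T)` (Prop. 2.22, p. 15) ↦ `diff0`; §2.4 p. 10 self-dual lattices ↦ `SelfDualLattice`, isometry ↦ `HermIso`, strict
similarity (Lem. 2.11 (ii), Rem. 4.1) ↦ `HermStrictSim`, type I/II (Rem. 2.15 (ii) p. 13) ↦ `IsTypeII`; the recorded sentences ↦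
`StackSentences`; the datum ↦ `Sec2Core`; §2.1 objects of `M(n−r,r)^naive(S)` (pp. 7–8) ↦ `Sec2Core.NaiveObj` (+ `Iso`, `baseChange`);
Ex. 2.2 `M₀(S)` ↦ `M0Obj` (+ `Iso`, `baseChange`); Def. 2.4 `M(n−r,r)(S)` ↦ `Obj` (+ `baseChange`); Not. 2.6 `M(S)` ↦ `MObj` (+ `baseChange`);
§2.2 `Hom_{O_k}(E,A)` ↦ `HomOK`; Def. 2.8 `Z(T)(S)` ↦ `ZObj` (+ `Iso`); §2.4 `R_{(n−r,r)}(k)` ↦ `IsRelevant`; Def. 2.18 `R^♯` ↦ `RelevantSharp` (+ `Iso`,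
`StrictSim`); Prop. 2.14 cases (a)/(b) ↦ `IsCaseA` / `IsCaseB`; `M[½]` ↦ `IsAwayFromTwo`; labels ↦ `Sec2Data`, `Sec2Data.label`.

READINGS (the only interpretive choices): R1 «`S` a locally noetherian `O_k`-scheme» = a scheme `S` with a morphism
`f : S → Spec O_k` (`[IsLocallyNoetherian S]` where a statement uses it); R2 «principal polarization» = ★ `Polarization` whose `λ`
is an isomorphism `A ≅ A^∨` (`IsIso pol.lam`); R3 `Hom_{O_k}(E, A)` = homomorphisms of `S`-group schemes commuting with the
actions (`HomOK`), its zero is the unit `1` of the (multiplicatively written) group `Hom_S(E, A)`; R6 `T ∈ Herm_m(O_k)_{>0}` =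
`IsPosDefHerm T`; R8/R9 «p inert» = `(p)` prime in `O_k` and `p ∤ Δ`, «p ramified» = `p ∣ Δ`, `Δ = NumberField.discr k`.

## References
* [KudlaRapoport2013] S. Kudla, M. Rapoport, *Special cycles on unitary Shimura varieties II: global theory*, J. reine angew. Math.
  697 (2014) 91–157 = arXiv:0912.3758v2, §2 pp. 7–15 (§2.1 pp. 7–9: (2.1), Prop. 2.1, Ex. 2.2, Rem. 2.3, Def. 2.4 (2.2)–(2.3),
  Thm. 2.5, Not. 2.6; §2.2 p. 9: (2.4), Def. 2.8 (2.5), Prop. 2.9; §2.3 p. 10: (2.6); §2.4 pp. 10–14: Lem. 2.11, Prop. 2.12, Prop.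
  2.14, Rem. 2.15, Def. 2.18, Prop. 2.19; §2.5 p. 15: Prop. 2.22).
* [Liu2021] Y. Liu, *Fourier–Jacobi cycles and arithmetic relative trace formula*, App. C (the tree's `HermSpace`, `conj`).
* [Kottwitz1992] R. Kottwitz, *Points on some Shimura varieties over finite fields*, JAMS 5 (1992) §5 (the determinant condition; ★
  `RingAction`, `lieCharpoly`).
-/

noncomputable section

open NumberField CategoryTheory CategoryTheory.Limits AlgebraicGeometry MonoidalCategory CartesianMonoidalCategory
open scoped MonObj
open Literature.AlgebraicGeometry.AbelianSchemes (AbelianSchemeOver)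
open Literature.NumberTheory.Automorphic.Liu2021.AppendixC (HermSpace conj)

namespace Literature.AlgebraicGeometry.ShimuraVarieties.KudlaRapoport2013.Sec2Defs

/-! ## Standing data of §2: «Let `k` be an imaginary quadratic field, with ring of integers `O_k`» (§1 p. 1; §2.1 p. 7) -/

variable (k : Type) [Field k] [NumberField k] [IsTotallyComplex k] [Algebra.IsQuadraticExtension ℚ k]

/-- `σ`, «the non-trivial automorphism of `O_k`» (§1 p. 1: the Rosati involution «induces the non-trivial automorphism of `O_k`»;
(2.1) «`a^σ`»): complex conjugation of the imaginary quadratic field `k` (★ `Liu2021.AppendixC.conj ℚ k`), restricted to `O_k`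
(Mathlib `RingOfIntegers.mapRingEquiv`). [cite: KudlaRapoport2013, §2.1 (2.1) (arXiv v2 p. 8)] -/
def sigmaInt : 𝓞 k ≃+* 𝓞 k :=
  NumberField.RingOfIntegers.mapRingEquiv (conj ℚ k).toRingEquiv

/-- `δ`, «the number of primes that ramify in `k`, i.e., the number of distinct prime divisors of `Δ`» (Lem. 2.11 (i), pp. 10–11).
For an imaginary quadratic field `|Δ| > 1`, so `δ ≥ 1` and `2^{δ−1}` below is the printed power (no truncated subtraction occurs).
[cite: KudlaRapoport2013, §2.4 Lemma 2.11 (arXiv v2 pp. 10–11)] -/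
def numRamifiedPrimes : ℕ := (NumberField.discr k).natAbs.primeFactors.card

/-- «`p` ramified in `k`» (READING R9): `p ∣ Δ`. [cite: KudlaRapoport2013, §2.4 proof of Lemma 2.11 (arXiv v2 p. 11)] -/
def IsRamifiedPrime (p : ℕ) : Prop := p.Prime ∧ p ∣ (NumberField.discr k).natAbs

/-- «`p` inert in `k`» (READING R9): `p ∤ Δ` and `p O_k` is a prime ideal. [cite: KudlaRapoport2013, §2.4 proof of Lemma 2.11 (arXiv v2 p. 11)] -/
def IsInertPrime (p : ℕ) : Prop :=
  p.Prime ∧ ¬ p ∣ (NumberField.discr k).natAbs ∧ (Ideal.span {(p : 𝓞 k)}).IsPrime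

/-- `T ∈ Herm_m(O_k)_{>0}` (READING R6; Def. 2.8, Lem. 2.20–Prop. 2.22): `T` is hermitian for `σ` (`T_{ji} = T_{ij}^σ`) and
`v ↦ ᵗv̄ T v` is positive definite on `O_k^m` — the value `∑ v_i^σ T_{ij} v_j` is a positive rational number for `v ≠ 0`.
[cite: KudlaRapoport2013, §2.2 Definition 2.8 (arXiv v2 p. 9)] -/
def IsPosDefHerm {m : ℕ} (T : Matrix (Fin m) (Fin m) (𝓞 k)) : Prop :=
  (∀ i j, T j i = sigmaInt k (T i j)) ∧
    ∀ v : Fin m → 𝓞 k, v ≠ 0 →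
      ∃ q : ℚ, 0 < q ∧ algebraMap ℚ k q = ∑ i, ∑ j, ((sigmaInt k (v i) * T i j * v j : 𝓞 k) : k)

/-- **`Diff₀(T)`** (Prop. 2.22, p. 15): «the set of primes `p` that are inert in `k` for which `ord_p(det(T))` is odd» — `det T ∈ O_k`
is `σ`-invariant for hermitian `T`, hence a rational integer `d`; the condition is `ord_p(d)` odd (false if `det T ∉ ℤ`).
[cite: KudlaRapoport2013, §2.5 Proposition 2.22 (arXiv v2 p. 15)] -/
def diff0 {m : ℕ} (T : Matrix (Fin m) (Fin m) (𝓞 k)) : Set ℕ :=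
  {p | IsInertPrime k p ∧ ∃ d : ℤ, (d : 𝓞 k) = T.det ∧ Odd (padicValInt p d)}

/-! ## §2.4 (REAL part): hermitian spaces over `k` (★ `HermSpace ℚ k`), self-dual `O_k`-lattices, relevance, isometry, strict similarity -/

/-- **A self-dual `O_k`-lattice in the hermitian space `V`** (§2.4 p. 10: relevant spaces «contain a self-dual `O_k`-lattice»; §1 (1.3):
«An `O_k`-lattice in `V` is self-dual for `( , )` iff it is self-dual for `⟨ , ⟩`»): a finitely generated `O_k`-stable subgroup `L`
of `V` spanning `V` over `k`, equal to its dual `L^∨ = {x ∈ V ∣ (x, L) ⊆ O_k}`. REAL over ★ `HermSpace.form` (basis-free dress; the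
squad's §3 file ★ `Sec3ComplexUniformization` types the same printed notion IN COORDINATES — `IsFullLattice`, `IsSelfDualFor σ J L`,
`LatticeDatum`, `IsSelfDualHermLattice` on `Submodule (𝓞 k) (Fin n → k)` with a Gram matrix `J`; by the squad's import direction of record
(the §3, §4, §5, … files import THIS file, never the reverse) the bridge — `L ↦ (V.gram, span of the ★ HermSpace.basis-coordinates of L)`,
under which «self-dual» here is `IsSelfDualFor (conj ℚ k) V.gram` there — lands in that file's ED. 2, not here).
[cite: KudlaRapoport2013, §2.4 (arXiv v2 p. 10)] -/
structure SelfDualLattice (V : HermSpace ℚ k) : Type where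
  /-- the underlying subgroup `L ⊂ V` -/
  carrier : AddSubgroup V.V
  /-- `L` is an `O_k`-submodule: `O_k · L ⊆ L` -/
  smul_mem : ∀ (a : 𝓞 k) (x : V.V), x ∈ carrier → ((a : k) • x) ∈ carrier
  /-- `L` is finitely generated -/
  fg : carrier.FG
  /-- `L` is a lattice in `V`: it spans `V` over `k` -/
  span_eq_top : Submodule.span k (carrier : Set V.V) = ⊤
  /-- `L = L^∨`: `x ∈ L` iff `(x, y) ∈ O_k` for all `y ∈ L` -/
  selfDual : ∀ x : V.V, x ∈ carrier ↔ ∀ y ∈ carrier, ∃ a : 𝓞 k, V.form x y = (a : k)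

/-- Isometry of hermitian spaces over `k` («isomorphism classes of hermitian spaces», §2.4 p. 10): a `k`-linear isomorphism
preserving the forms. [cite: KudlaRapoport2013, §2.4 (arXiv v2 p. 10)] -/
def HermIso (V W : HermSpace ℚ k) : Prop :=
  ∃ e : V.V ≃ₗ[k] W.V, ∀ x y : V.V, W.form (e x) (e y) = V.form x y

/-- **Strict similarity** (Lem. 2.11 (ii) p. 11: «by a strict similarity we mean a similarity such that the scale factor is positive»;
Rem. 4.1: `( , )' = c ( , )` for `c ∈ ℚ^×_+`): a `k`-linear isomorphism scaling the form by a positive rational number.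
[cite: KudlaRapoport2013, §2.4 Lemma 2.11 (ii) (arXiv v2 p. 11)] -/
def HermStrictSim (V W : HermSpace ℚ k) : Prop :=
  ∃ e : V.V ≃ₗ[k] W.V, ∃ c : ℚ, 0 < c ∧ ∀ x y : V.V, W.form (e x) (e y) = algebraMap ℚ k c * V.form x y

/-- **Type II / type I self-dual lattices** (Rem. 2.15 (ii) p. 13): «we will call a self-dual (unimodular) hermitian lattice type II if
the values `(x,x)` for `x ∈ L` are all even and type I otherwise» (`(x,x) = (x,x)^σ` is a rational integer on a self-dual lattice;
«even» = `(x,x) ∈ 2ℤ`). [cite: KudlaRapoport2013, §2.4 Remark 2.15 (ii) (arXiv v2 p. 13)] -/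
def IsTypeII {V : HermSpace ℚ k} (L : SelfDualLattice k V) : Prop :=
  ∀ x ∈ L.carrier, ∃ m : ℤ, V.form x x = algebraMap ℚ k (2 * m)

/-! ## The six stack-level sentences of §2 (recorded tokens) -/

/-- **RECORDED STACK-LEVEL SENTENCES of §2** — Deligne–Mumford stacks and smoothness / flatness / relative representability of
morphisms of stacks have no vocabulary in Mathlib or the tree; each field is the printed sentence, kept as a `Prop` TOKEN the
consumer instantiates (placeholders: no REAL content is claimed for them in this file, and no predicate below mixes them with
REAL clauses except by conjunction). (1) Prop. 2.1 «`M(n−r,r)^naive` is a Deligne–Mumford stack over `Spec O_k`»; (2) Prop. 2.1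
«`M(n−r,r)^naive ×_{Spec O_k} Spec O_k[Δ⁻¹]` is smooth of relative dimension `(n−r)r` over `Spec O_k[Δ⁻¹]`» (token indexed by the
relative dimension); (3) Rem. 2.3 «`M(n−r,r)^naive` is not flat over `Spec O_k` for `n ≥ 3`» (token = «is flat»); (4) Thm. 2.5 «the
stack `M(n−1,1)` is flat over `Spec O_k`» (token = «`M(n−r,r)` is flat over `Spec O_k`»); (5) Prop. 2.9 «`Z(T)` is representable by
a DM-stack»; (6) Prop. 2.9 «the natural morphism `Z(T) → M` is finite and unramified».
[cite: KudlaRapoport2013, §2.1 Proposition 2.1, Remark 2.3, Theorem 2.5 (arXiv v2 p. 8); §2.2 Proposition 2.9 (arXiv v2 p. 9)] -/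
structure StackSentences : Type where
  /-- ⟨TOKEN⟩ (1) «`M(n−r,r)^naive` is a Deligne–Mumford stack over `Spec O_k`» (Prop. 2.1). -/
  naiveIsDMStack : Prop
  /-- ⟨TOKEN⟩ (2) «`M(n−r,r)^naive[Δ⁻¹]` is smooth of relative dimension `d` over `Spec O_k[Δ⁻¹]`» (Prop. 2.1, `d = (n−r)r`). -/
  naiveSmoothAwayFromDisc : ℕ → Prop
  /-- ⟨TOKEN⟩ (3) «`M(n−r,r)^naive` is flat over `Spec O_k`» (negated in Rem. 2.3 for `n ≥ 3`). -/
  naiveIsFlat : Prop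
  /-- ⟨TOKEN⟩ (4) «`M(n−r,r)` is flat over `Spec O_k`» (Thm. 2.5, Pappas, for `r = 1`, `2 ∤ Δ`). -/
  isFlat : Prop
  /-- ⟨TOKEN⟩ (5) «`Z(T)` is representable by a DM-stack» (Prop. 2.9). -/
  cycleIsDMStack : ∀ {m : ℕ}, Matrix (Fin m) (Fin m) (𝓞 k) → Prop
  /-- ⟨TOKEN⟩ (6) «the natural morphism `Z(T) → M` is finite and unramified» (Prop. 2.9). -/
  cycleToMFiniteUnramified : ∀ {m : ℕ}, Matrix (Fin m) (Fin m) (𝓞 k) → Prop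

/-! ## The datum of §2, part 1: numerics, clause predicates and the label-free carriers (`Sec2Core`) -/

/-- **The datum of [KudlaRapoport2013] §2, part 1 (`Sec2Core`).** REAL: «an integer `n ≥ 1` and a decomposition `n = (n−r) + r` with
`0 ≤ r ≤ n`» (§2.1 p. 7).  ⟨CARRIER⟩ (posited functions / predicates standing for printed notions Mathlib / the tree cannot evaluate
on a general base; each quotes its print; every carrier here is TOTAL with an inhabited codomain chosen by the consumer, so junk
values exist off the moduli problems; nothing is asserted about them): the signature condition (2.1) and the wedge condition (2.2)
on `Lie A`, the Rosati condition, pull-back of polarizations along an isomorphism, with their ⟨CARRIER LAW⟩s of stability under base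
change (used only to base-change OBJECTS, `Obj.baseChange`); the hermitian form `h'` (2.4) on `Hom_{O_k}(E, A)` (REAL codomain
`O_k`); the Tate-module hermitian modules and forms `h'`, `h` of §2.3; the `G₁^V`-genus and `G^V(𝔸_f)^0`-orbit relations on
self-dual lattices (p. 12, Lem. 2.17); local self-dual lattices and `U(V_p)`-orbits (Prop. 2.14); «`V₂` split» / «`V₂` = anisotropic
plane ⊕ split» (Prop. 2.14 (a)(b)); the local invariants `inv_ℓ(V)`, `inv_ℓ(V_T)` (proof of Lem. 2.11, Prop. 2.22); «supersingular»
(Lem. 2.21); and the recorded `StackSentences`.  The OBJECT-DEPENDENT carriers (the labels `V(ξ)`, `Hom_k(V(ξ₀),V(ξ))` of Prop.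
2.12 / 2.19) live in `Sec2Data C` below, defined on objects only. [cite: KudlaRapoport2013, §2.1–§2.5 (arXiv v2 pp. 7–15)] -/
structure Sec2Core : Type 2 where
  /-- «an integer `n ≥ 1`» (§2.1 p. 7). -/
  n : ℕ
  /-- «a decomposition `n = (n−r) + r` with `0 ≤ r ≤ n`» (§2.1 p. 7). -/
  r : ℕ
  /-- «`n ≥ 1`». -/
  one_le_n : 1 ≤ n
  /-- «`0 ≤ r ≤ n`». -/
  r_le_n : r ≤ n
  /-- ⟨CARRIER⟩ **the signature condition (2.1) of type `(a, b)`** for an abelian scheme `A` over an `O_k`-scheme `f : S → Spec O_k`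
  with `O_k`-action `ι`: «`char(T, ι(α) ∣ Lie A) = (T − φ(α))^{a} (T − φ(α^σ))^{b}`, `α ∈ O_k`, where `φ : O_k → 𝒪_S` is the
  structure homomorphism; the left side is the characteristic polynomial in `𝒪_S[T]` of the `𝒪_S`-module endomorphism of `Lie A`
  induced by `ι(α)` and the right side is the image of a polynomial in `O_k[T]`» (p. 8; the moduli problem uses `(a, b) = (n−r, r)`,
  `M₀` uses `(1, 0)`).  Evaluated by a consumer over local affine bases with ★ `AbelianSchemeOver.lieCharpoly`. -/
  IsSignature : ∀ {S : Scheme.{0}}, (S ⟶ Spec (.of (𝓞 k))) → ∀ A : AbelianSchemeOver S, A.RingAction (𝓞 k) → ℕ → ℕ → Prop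
  /-- ⟨CARRIER⟩ **the wedge condition (2.2) of type `(a, b)`** (Def. 2.4 p. 8): «the action of `O_k` on `Lie A` satisfies
  `∧^{b+1}(ι(a) − a) = 0`, `∧^{a+1}(ι(a) − a^σ) = 0`» (printed for `(a, b) = (n−r, r)` in v2 as `∧^{r+1}(ι(a) − a) = 0`,
  `∧^{n−r+1}(ι(a) − a^σ) = 0` — the order consistent with (2.1); READING NOTE: the held v1 TeX prints the two exponents swapped). -/
  IsWedge : ∀ {S : Scheme.{0}}, (S ⟶ Spec (.of (𝓞 k))) → ∀ A : AbelianSchemeOver S, A.RingAction (𝓞 k) → ℕ → ℕ → Prop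
  /-- ⟨CARRIER⟩ «`ι(a)^* = ι(a^σ)` for the corresponding Rosati involution `*`» of the polarization `λ` (§2.1 p. 8). -/
  RosatiIsConj : ∀ {S : Scheme.{0}} (A : AbelianSchemeOver S) (Dp : A.DualPair), A.Polarization Dp → A.RingAction (𝓞 k) → Prop
  /-- ⟨CARRIER⟩ «`φ^*(λ') = λ`» for an isomorphism `φ : A → A'` (§2.1 p. 8): `λ = φ^∨ ∘ λ' ∘ φ`. -/
  PolPullback : ∀ {S : Scheme.{0}} {A A' : AbelianSchemeOver S} {Dp : A.DualPair} {Dp' : A'.DualPair},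
    (A.X ≅ A'.X) → A.Polarization Dp → A'.Polarization Dp' → Prop
  /-- ⟨CARRIER LAW⟩ the signature condition is stable under base change `g : S' → S` (a characteristic polynomial of a locally free
  module commutes with base change; ★ `lieCharpoly_baseChange`). -/
  isSignature_baseChange : ∀ {S S' : Scheme.{0}} (g : S' ⟶ S) (f : S ⟶ Spec (.of (𝓞 k))) (A : AbelianSchemeOver S)
    (ιA : A.RingAction (𝓞 k)) (a b : ℕ), IsSignature f A ιA a b → IsSignature (g ≫ f) (A.baseChange g) (ιA.baseChange g) a b
  /-- ⟨CARRIER LAW⟩ the wedge condition is stable under base change. -/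
  isWedge_baseChange : ∀ {S S' : Scheme.{0}} (g : S' ⟶ S) (f : S ⟶ Spec (.of (𝓞 k))) (A : AbelianSchemeOver S)
    (ιA : A.RingAction (𝓞 k)) (a b : ℕ), IsWedge f A ιA a b → IsWedge (g ≫ f) (A.baseChange g) (ιA.baseChange g) a b
  /-- ⟨CARRIER LAW⟩ the Rosati condition is stable under base change (★ `Polarization.baseChange`, `RingAction.baseChange`). -/
  rosati_baseChange : ∀ {S S' : Scheme.{0}} (g : S' ⟶ S) (A : AbelianSchemeOver S) (Dp : A.DualPair) (pol : A.Polarization Dp)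
    (ιA : A.RingAction (𝓞 k)), RosatiIsConj A Dp pol ιA → RosatiIsConj (A.baseChange g) (Dp.baseChange g) (pol.baseChange g) (ιA.baseChange g)
  /-- ⟨LAW⟩ (REAL, provable: `(pol.baseChange g).lam = (Over.pullback g).map pol.lam`, ★ `baseChange_lam`, and functors preserve
  isomorphisms) «principal» is stable under base change; kept as a field so that this statements-only file carries no proof. -/
  principal_baseChange : ∀ {S S' : Scheme.{0}} (g : S' ⟶ S) (A : AbelianSchemeOver S) (Dp : A.DualPair) (pol : A.Polarization Dp),
    IsIso pol.lam → IsIso (pol.baseChange g).lam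
  /-- ⟨CARRIER⟩ **the hermitian form `h'` (2.4)** on `V'(A, E) = Hom_{O_k}(E, A)` (§2.2 p. 9): «`h'(x, y) = ι₀^{-1}(λ₀^{-1} ∘ y^∨ ∘ λ ∘ x)
  ∈ O_k`, where `y^∨ : A^∨ → E^∨` denotes the dual homomorphism», for `(E, ι₀, λ₀)`, `(A, ι, λ)` over a common base; REAL codomain
  `O_k`; defined on all `S`-morphisms `E → A` (junk off `Hom_{O_k}(E, A)`). -/
  hermForm : ∀ {S : Scheme.{0}} {E A : AbelianSchemeOver S}, E.RingAction (𝓞 k) → A.RingAction (𝓞 k) →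
    ∀ {D₀ : E.DualPair} {Dp : A.DualPair}, E.Polarization D₀ → A.Polarization Dp → (E.X ⟶ A.X) → (E.X ⟶ A.X) → 𝓞 k
  /-- ⟨CARRIER⟩ the coefficient ring `k ⊗ 𝔸_f^p` of §2.3 (p. 10), indexed by the residue characteristic `p` (a type; only equalities
  of its elements are used). -/
  TateCoeff : ℕ → Type
  /-- ⟨CARRIER⟩ `O_k → k ⊗ 𝔸_f^p`, the map through which `h'` on `V'(A,E)` is compared with `h'` on `V'_{𝔸_f^p}` (p. 10). -/
  tateCoeffMap : ∀ p : ℕ, 𝓞 k → TateCoeff p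
  /-- ⟨CARRIER⟩ **`V'_{𝔸_f^p} = Hom_{k ⊗ 𝔸_f^p}(T^p(E)^0, T^p(A)^0)`** (§2.3 p. 10) for `(A, ι, λ; E, ι₀, λ₀)` over an algebraically
  closed field of characteristic `p` («Hence we may replace the base scheme `Spec F` by any connected scheme `S`» — typed at field
  points only); a type chosen by the consumer. -/
  TateHom : ∀ (p : ℕ) {F : Type} [Field F] {E A : AbelianSchemeOver (Spec (.of F))}, E.RingAction (𝓞 k) → A.RingAction (𝓞 k) → Type
  /-- ⟨CARRIER⟩ «the natural embedding `V'(A, E) → V'_{𝔸_f^p}`» (p. 10), on all `S`-morphisms `E → A`. -/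
  tateEmb : ∀ (p : ℕ) {F : Type} [Field F] {E A : AbelianSchemeOver (Spec (.of F))} (ι₀ : E.RingAction (𝓞 k))
    (ιA : A.RingAction (𝓞 k)), (E.X ⟶ A.X) → TateHom p ι₀ ιA
  /-- ⟨CARRIER⟩ the form `h'(x, y) = ι₀^{-1}(λ₀^{-1} ∘ y^∨ ∘ λ ∘ x) ∈ k ⊗ 𝔸_f^p` on `V'_{𝔸_f^p}` (p. 10). -/
  tateForm' : ∀ (p : ℕ) {F : Type} [Field F] {E A : AbelianSchemeOver (Spec (.of F))} (ι₀ : E.RingAction (𝓞 k))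
    (ιA : A.RingAction (𝓞 k)) {D₀ : E.DualPair} {Dp : A.DualPair}, E.Polarization D₀ → A.Polarization Dp →
      TateHom p ι₀ ιA → TateHom p ι₀ ιA → TateCoeff p
  /-- ⟨CARRIER⟩ the form `h( , )` on `Hom(T^p(E)^0, T^p(A)^0)` defined by the Weil-pairing hermitian forms `h_λ`, `h_{λ₀}` of (2.6)
  «`2 h_λ(x, y) = e_A(δx, λ(y)) + δ e_A(x, λ(y))`, `δ = √Δ`», «independent of the trivialization of `𝔸_f^p(1)`» (p. 10). -/
  tateFormWeil : ∀ (p : ℕ) {F : Type} [Field F] {E A : AbelianSchemeOver (Spec (.of F))} (ι₀ : E.RingAction (𝓞 k))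
    (ιA : A.RingAction (𝓞 k)) {D₀ : E.DualPair} {Dp : A.DualPair}, E.Polarization D₀ → A.Polarization Dp →
      TateHom p ι₀ ιA → TateHom p ι₀ ιA → TateCoeff p
  /-- ⟨CARRIER⟩ **`[[L]] = [[L']]`**: the self-dual lattices `L`, `L'` of `V` lie in the same `G₁^V`-genus (p. 12: «`G₁^V(𝔸_f)` acts on
  the set of self dual lattices in `V` by `g : L ↦ V ∩ (g(L ⊗ Ẑ))`. The orbit of a lattice `L` is the `G₁^V`-genus of `L`»,
  `G₁^V = U(V)` = ★ `HermSpace.Gfin`). -/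
  SameGenus : ∀ {V : HermSpace ℚ k}, SelfDualLattice k V → SelfDualLattice k V → Prop
  /-- ⟨CARRIER⟩ same orbit under `G^V(𝔸_f)^0 = {g ∈ G^V(𝔸_f) ∣ ν(g) ∈ Ẑ^×}` (Lem. 2.17 p. 13), `G^V = GU(V)`. -/
  SameGenus0 : ∀ {V : HermSpace ℚ k}, SelfDualLattice k V → SelfDualLattice k V → Prop
  /-- ⟨CARRIER⟩ the self-dual `O_{k,p}`-lattices in `V_p = V ⊗_ℚ ℚ_p` (Prop. 2.14 p. 12), a type. -/
  LocSelfDual : HermSpace ℚ k → ℕ → Type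
  /-- ⟨CARRIER⟩ same `U(V_p)`-orbit of self-dual lattices in `V_p` (Prop. 2.14). -/
  locSameOrbit : ∀ {V : HermSpace ℚ k} {p : ℕ}, LocSelfDual V p → LocSelfDual V p → Prop
  /-- ⟨CARRIER⟩ «`V₂` is a split space» (Prop. 2.14 (a)). -/
  IsSplitAtTwo : HermSpace ℚ k → Prop
  /-- ⟨CARRIER⟩ «`V₂` is the sum of a `2`-dimensional anisotropic space and a split space of dimension `n − 2`» (Prop. 2.14 (b)). -/
  IsAnisoPlusSplitAtTwo : HermSpace ℚ k → Prop
  /-- ⟨CARRIER⟩ the local invariant `inv_ℓ(V) = (det V, Δ)_ℓ ∈ {±1}` of a hermitian space at a finite prime `ℓ` (proof of Lem. 2.11 p. 11;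
  Prop. 2.22). -/
  locInv : HermSpace ℚ k → ℕ → ℤˣ
  /-- ⟨CARRIER⟩ `inv_ℓ(V_T)` for «the positive-definite hermitian space `V_T = k^m` with hermitian form given by `T`» (Prop. 2.22 p. 15). -/
  locInvMat : ∀ {m : ℕ}, Matrix (Fin m) (Fin m) (𝓞 k) → ℕ → ℤˣ
  /-- ⟨CARRIER⟩ «supersingular» for an abelian scheme over a field (Lem. 2.21, Prop. 2.22: «the supersingular locus of `M_p`»). -/
  IsSupersingular : ∀ {F : Type} [Field F], AbelianSchemeOver (Spec (.of F)) → Prop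
  /-- the recorded stack-level sentences (Prop. 2.1, Rem. 2.3, Thm. 2.5, Prop. 2.9). -/
  stack : StackSentences k

namespace Sec2Core

variable {k}
variable (C : Sec2Core k)

/-! ### §2.1 (pp. 7–9): objects of `M(n−r,r)^naive(S)` and `M(n−r,r)(S)` (Def. 2.4); `M₀(S)` (Ex. 2.2); `M(S)` (Not. 2.6) -/

/-- **An object of `M(n−r,r)^naive(S)`** for an `O_k`-scheme `f : S → Spec O_k` (§2.1 pp. 7–8): «triples `(A, ι, λ)`. Here `A` is an
abelian scheme over `S`, `ι : O_k → End_S(A)` is an action of `O_k` on `A`, and `λ : A → A^∨` is a principal polarization such that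
`ι(a)^* = ι(a^σ)` for the corresponding Rosati involution `*`. In addition, the following signature condition is imposed:
`char(T, ι(a) ∣ Lie A) = (T − φ(a))^{n−r} (T − φ(a^σ))^r`, `a ∈ O_k` (2.1)».  REAL `A`, `ι` (field `ιA`), `λ` (READING R2: principal =
`λ` is an isomorphism); the Rosati and signature clauses through the datum's ⟨CARRIER⟩ predicates. (= v1 §2.1.)
[cite: KudlaRapoport2013, §2.1 (2.1) (arXiv v2 pp. 7–8)] -/
structure NaiveObj {S : Scheme.{0}} (f : S ⟶ Spec (.of (𝓞 k))) : Type 1 where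
  /-- «`A` is an abelian scheme over `S`» (★ `AbelianSchemeOver S`). -/
  A : AbelianSchemeOver S
  /-- «`ι : O_k → End_S(A)` is an action of `O_k` on `A`» (★ `RingAction (𝓞 k)`). -/
  ιA : A.RingAction (𝓞 k)
  /-- the dual pair `(A^∨, 𝒫)` carrying `λ` (★ `DualPair`). -/
  Dp : A.DualPair
  /-- «`λ : A → A^∨`» a polarization (★ `Polarization`). -/
  pol : A.Polarization Dp
  /-- «principal»: `λ` is an isomorphism (READING R2). -/
  principal : IsIso pol.lam
  /-- «`ι(a)^* = ι(a^σ)` for the corresponding Rosati involution» (⟨CARRIER⟩). -/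
  rosati : C.RosatiIsConj A Dp pol ιA
  /-- **(2.1)** the signature condition of type `(n−r, r)` (⟨CARRIER⟩). -/
  signature : C.IsSignature f A ιA (C.n - C.r) C.r

/-- **A morphism in `M(n−r,r)^naive(S)`** (p. 8): «an `O_k`-linear isomorphism `φ : A → A'` such that `φ^*(λ') = λ`» — REAL isomorphism
of `S`-GROUP schemes (`IsMonHom`, as in `HomOK`) commuting with the actions, ⟨CARRIER⟩ pull-back clause; as the relation «isomorphic».
[cite: KudlaRapoport2013, §2.1 (arXiv v2 p. 8)] -/
def NaiveObj.Iso {C : Sec2Core k} {S : Scheme.{0}} {f : S ⟶ Spec (.of (𝓞 k))} (x y : C.NaiveObj f) : Prop :=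
  ∃ e : x.A.X ≅ y.A.X, IsMonHom e.hom ∧ (∀ a : 𝓞 k, e.hom ≫ y.ιA.i a = x.ιA.i a ≫ e.hom) ∧ C.PolPullback e x.pol y.pol

/-- Base change of an object of `M(n−r,r)^naive(S)` along `g : S' → S` (the groupoid is «fibered over `(Sch/Spec O_k)`», p. 7): REAL base
change of `A`, `ι`, `(A^∨, 𝒫)`, `λ` (★ `baseChange`), the clauses transported by the datum's ⟨CARRIER LAW⟩s.
[cite: KudlaRapoport2013, §2.1 (arXiv v2 p. 7)] -/
def NaiveObj.baseChange {C : Sec2Core k} {S S' : Scheme.{0}} {f : S ⟶ Spec (.of (𝓞 k))} (x : C.NaiveObj f) (g : S' ⟶ S) :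
    C.NaiveObj (g ≫ f) where
  A := x.A.baseChange g
  ιA := x.ιA.baseChange g
  Dp := x.Dp.baseChange g
  pol := x.pol.baseChange g
  principal := C.principal_baseChange g x.A x.Dp x.pol x.principal
  rosati := C.rosati_baseChange g x.A x.Dp x.pol x.ιA x.rosati
  signature := C.isSignature_baseChange g f x.A x.ιA (C.n - C.r) C.r x.signature

/-- **An object of `M₀(S) = M(1,0)^naive(S)`** (Ex. 2.2 p. 8): «Let `n = 1`, `r = 0`. Then `M(1,0)^naive` parametrizes triples
`(E, ι₀, λ₀)` where `(E, ι)` is an elliptic curve with complex multiplication by `O_k` such that the action of `O_k` on `Lie E` is the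
natural one … We will abbreviate `M(1,0)^naive` to `M₀`» — the same clauses as `NaiveObj` with signature type `(1, 0)`. (= v1 Ex. 2.3.)
[cite: KudlaRapoport2013, §2.1 Example 2.2 (arXiv v2 p. 8)] -/
structure M0Obj {S : Scheme.{0}} (f : S ⟶ Spec (.of (𝓞 k))) : Type 1 where
  /-- the elliptic curve `E` over `S` (an abelian scheme; relative dimension `1` by `relDim_of_signature`). -/
  E : AbelianSchemeOver S
  /-- «complex multiplication by `O_k`»: the action `ι₀`. -/
  ι₀ : E.RingAction (𝓞 k)
  /-- the dual pair carrying `λ₀`. -/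
  D₀ : E.DualPair
  /-- the polarization `λ₀`. -/
  pol₀ : E.Polarization D₀
  /-- `λ₀` is principal. -/
  principal : IsIso pol₀.lam
  /-- Rosati condition. -/
  rosati : C.RosatiIsConj E D₀ pol₀ ι₀
  /-- «the action of `O_k` on `Lie E` is the natural one»: signature type `(1, 0)`. -/
  signature : C.IsSignature f E ι₀ 1 0

/-- Isomorphisms in `M₀(S)` (as for `NaiveObj.Iso`). [cite: KudlaRapoport2013, §2.1 Example 2.2 (arXiv v2 p. 8)] -/
def M0Obj.Iso {C : Sec2Core k} {S : Scheme.{0}} {f : S ⟶ Spec (.of (𝓞 k))} (x y : C.M0Obj f) : Prop :=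
  ∃ e : x.E.X ≅ y.E.X, IsMonHom e.hom ∧ (∀ a : 𝓞 k, e.hom ≫ y.ι₀.i a = x.ι₀.i a ≫ e.hom) ∧ C.PolPullback e x.pol₀ y.pol₀

/-- Base change of an object of `M₀(S)` along `g : S' → S` (as `NaiveObj.baseChange`). [cite: KudlaRapoport2013, §2.1 Example 2.2 (arXiv v2 p. 8)] -/
def M0Obj.baseChange {C : Sec2Core k} {S S' : Scheme.{0}} {f : S ⟶ Spec (.of (𝓞 k))} (x : C.M0Obj f) (g : S' ⟶ S) :
    C.M0Obj (g ≫ f) where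
  E := x.E.baseChange g
  ι₀ := x.ι₀.baseChange g
  D₀ := x.D₀.baseChange g
  pol₀ := x.pol₀.baseChange g
  principal := C.principal_baseChange g x.E x.D₀ x.pol₀ x.principal
  rosati := C.rosati_baseChange g x.E x.D₀ x.pol₀ x.ι₀ x.rosati
  signature := C.isSignature_baseChange g f x.E x.ι₀ 1 0 x.signature

/-- **An object of `M(n−r,r)(S)`** — **[KR2013, Definition 2.4]** (p. 8): «Let `M(n−r,r)` be the closed substack of `M(n−r,r)^naive`
consisting of those triples `(A, ι, λ)` for which the action of `O_k` on `Lie A` satisfies the wedge condition: `∧^{r+1}(ι(a) − a) = 0`,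
`∧^{n−r+1}(ι(a) − a^σ) = 0` (2.2)».  A `NaiveObj` with the ⟨CARRIER⟩ wedge clause. (= v1 Def. 2.5.)
[cite: KudlaRapoport2013, §2.1 Definition 2.4 (2.2) (arXiv v2 p. 8)] -/
structure Obj {S : Scheme.{0}} (f : S ⟶ Spec (.of (𝓞 k))) : Type 1 extends C.NaiveObj f where
  /-- **(2.2)** the wedge condition of type `(n−r, r)` (⟨CARRIER⟩). -/
  wedge : C.IsWedge f A ιA (C.n - C.r) C.r

/-- Base change of an object of `M(n−r,r)(S)` along `g : S' → S`. [cite: KudlaRapoport2013, §2.1 Definition 2.4 (arXiv v2 p. 8)] -/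
def Obj.baseChange {C : Sec2Core k} {S S' : Scheme.{0}} {f : S ⟶ Spec (.of (𝓞 k))} (x : C.Obj f) (g : S' ⟶ S) : C.Obj (g ≫ f) where
  toNaiveObj := x.toNaiveObj.baseChange g
  wedge := C.isWedge_baseChange g f x.A x.ιA (C.n - C.r) C.r x.wedge

/-- **An object of `M(S)`, [KR2013, Notation 2.6]** (p. 9): «`M = M(n−r,r) ×_{Spec O_k} M₀`, the base change of `M(k; n−r,r)` to `M₀`» —
an `S`-point is a pair of an object of `M(n−r,r)(S)` and an object of `M₀(S)` over the same `f : S → Spec O_k`. (= v1 Not. 2.7.)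
[cite: KudlaRapoport2013, §2.1 Notation 2.6 (arXiv v2 p. 9)] -/
structure MObj {S : Scheme.{0}} (f : S ⟶ Spec (.of (𝓞 k))) : Type 1 where
  /-- the component `(A, ι, λ) ∈ M(n−r,r)(S)` -/
  pt : C.Obj f
  /-- the component `(E, ι₀, λ₀) ∈ M₀(S)` -/
  pt₀ : C.M0Obj f

/-- Base change of an `S`-point of `M` along `g : S' → S`. [cite: KudlaRapoport2013, §2.1 Notation 2.6 (arXiv v2 p. 9)] -/
def MObj.baseChange {C : Sec2Core k} {S S' : Scheme.{0}} {f : S ⟶ Spec (.of (𝓞 k))} (y : C.MObj f) (g : S' ⟶ S) : C.MObj (g ≫ f) where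
  pt := y.pt.baseChange g
  pt₀ := y.pt₀.baseChange g

/-! ### §2.2 (p. 9): `V'(A,E) = Hom_{O_k}(E,A)` and the objects of the special cycle `Z(T)(S)` (Def. 2.8) -/

/-- **`V'(A, E) = Hom_{O_k}(E, A)`** (§2.2 p. 9: «the free `O_k`-module of finite rank `V'(A,E) = Hom_{O_k}(E,A)`»), READING R3: the
`S`-group-scheme homomorphisms `E → A` commuting with the `O_k`-actions. REAL. [cite: KudlaRapoport2013, §2.2 (arXiv v2 p. 9)] -/
def HomOK {S : Scheme.{0}} {E A : AbelianSchemeOver S} (ι₀ : E.RingAction (𝓞 k)) (ιA : A.RingAction (𝓞 k)) : Type :=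
  {u : E.X ⟶ A.X // IsMonHom u ∧ ∀ a : 𝓞 k, u ≫ ιA.i a = ι₀.i a ≫ u}

/-- **An object of the special cycle `Z(T)(S)` — [KR2013, Definition 2.8]** (p. 9): «Let `T ∈ Herm_m(O_k)` be an `m × m` hermitian
matrix, `m ≥ 1`, with coefficients in `O_k`. The special cycle `Z(T)` attached to `T` is the stack of collections
`(A, ι, λ, E, ι₀, λ₀; x)` where `(A, ι, λ) ∈ M(n−r,r)(S)`, `(E, ι₀, λ₀) ∈ M₀(S)`, and `x = [x_1, …, x_m] ∈ Hom_{O_k}(E, A)^m` is an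
`m`-tuple of homomorphisms such that `h'(x, x) = (h'(x_i, x_j)) = T` (2.5)».  REAL over `MObj` and `HomOK`, the fundamental-matrix
clause through the ⟨CARRIER⟩ `h'`.  (`m = 0` is admitted as harmless junk — print: `m ≥ 1`; the statements about `Z(T)` carry `1 ≤ m`
where it matters.) (= v1 Def. 2.9.) [cite: KudlaRapoport2013, §2.2 Definition 2.8 (2.5) (arXiv v2 p. 9)] -/
structure ZObj {S : Scheme.{0}} (f : S ⟶ Spec (.of (𝓞 k))) {m : ℕ} (T : Matrix (Fin m) (Fin m) (𝓞 k)) : Type 1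
    extends C.MObj f where
  /-- «`x = [x_1, …, x_m] ∈ Hom_{O_k}(E, A)^m`» -/
  x : Fin m → HomOK pt₀.ι₀ pt.ιA
  /-- **(2.5)** «`h'(x, x) = (h'(x_i, x_j)) = T`», the fundamental matrix. -/
  fundamental : ∀ i j : Fin m, C.hermForm pt₀.ι₀ pt.ιA pt₀.pol₀ pt.pol (x i).1 (x j).1 = T i j

/-- **Isomorphism of two points of `Z(T)(S)`** (Def. 2.8 with the morphisms of §2.1 p. 8): isomorphisms `(A, ι, λ) ≅ (A', ι', λ')` in
`M(n−r,r)(S)` and `(E, ι₀, λ₀) ≅ (E', ι₀', λ₀')` in `M₀(S)` (REAL isomorphisms of `S`-group schemes commuting with the actions, ⟨CARRIER⟩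
polarization pull-back) carrying `x_i` to `x_i'` (`x_i' ∘ e₀ = e ∘ x_i`). REAL. [cite: KudlaRapoport2013, §2.2 Definition 2.8 (arXiv v2 p. 9)] -/
def ZObj.Iso {C : Sec2Core k} {S : Scheme.{0}} {f : S ⟶ Spec (.of (𝓞 k))} {m : ℕ} {T : Matrix (Fin m) (Fin m) (𝓞 k)}
    (z z' : C.ZObj f T) : Prop :=
  ∃ (e : z.pt.A.X ≅ z'.pt.A.X) (e₀ : z.pt₀.E.X ≅ z'.pt₀.E.X),
    IsMonHom e.hom ∧ (∀ a : 𝓞 k, e.hom ≫ z'.pt.ιA.i a = z.pt.ιA.i a ≫ e.hom) ∧ C.PolPullback e z.pt.pol z'.pt.pol ∧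
    IsMonHom e₀.hom ∧ (∀ a : 𝓞 k, e₀.hom ≫ z'.pt₀.ι₀.i a = z.pt₀.ι₀.i a ≫ e₀.hom) ∧ C.PolPullback e₀ z.pt₀.pol₀ z'.pt₀.pol₀ ∧
    ∀ i : Fin m, (z.x i).1 ≫ e.hom = e₀.hom ≫ (z'.x i).1

/-! ### §2.4 (pp. 10–14): relevant hermitian spaces `R_{(n−r,r)}(k)`, `R^♯` (Def. 2.18), the cases (a)/(b) of Prop. 2.14, `M[½]` -/

/-- **`V ∈ R_{(n−r,r)}(k)`** (§2.4 p. 10): «the set of isomorphism classes of hermitian spaces `V` with `sig(V) = (n−r, r)` and which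
contain a self-dual `O_k`-lattice», `V` of dimension `n` over `k`; `sig` = ★ `HermSpace.sig` at the real place of `ℚ`
(`(n−r)` positive, `r` negative signs). REAL (basis-free; in ★ `HermSpace.basis`-coordinates this is the §3 file's ★ `IsSelfDualHermLattice σ τ r`
for the Gram matrix `V.gram` — bridge in that file's ED. 2). [cite: KudlaRapoport2013, §2.4 (arXiv v2 p. 10)] -/
def IsRelevant (V : HermSpace ℚ k) : Prop :=
  V.n = C.n ∧ V.sig (algebraMap ℚ ℝ) = (C.n - C.r, C.r) ∧ Nonempty (SelfDualLattice k V)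

/-- **An element of `R_{(n−r,r)}(k)^♯` — [KR2013, Definition 2.18]** (p. 13): «the set of isomorphism classes of pairs `V^♯ := (V, [[L]])`
where `V` is a relevant hermitian space and `[[L]]` is a `G₁^V`-genus of self-dual hermitian lattices in `V`» — a relevant `V` with a
self-dual lattice `L` representing the genus.  (Declared before Lem. 2.11 because the labels of Prop. 2.12 / 2.19 land here; this type is
inhabited: `O_k^n ⊂ k^n` with the diagonal form `diag(1^{n−r}, (−1)^r)` is self-dual.) (= v1 Def. 2.19.)
[cite: KudlaRapoport2013, §2.4 Definition 2.18 (arXiv v2 p. 13)] -/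
structure RelevantSharp : Type 1 where
  /-- the relevant hermitian space `V` -/
  V : HermSpace ℚ k
  /-- `V ∈ R_{(n−r,r)}(k)` -/
  relevant : C.IsRelevant V
  /-- a self-dual lattice `L`, representing the genus `[[L]]` -/
  L : SelfDualLattice k V

/-- Isomorphism of pairs `(V, [[L]]) ≅ (V', [[L']])` (Def. 2.18: «isomorphism classes of pairs»): an isometry `e : V ≅ V'` carrying the
genus of `L` to that of `L'` — every self-dual lattice of `V'` with underlying group `e(L)` lies in the genus of `L'`.
[cite: KudlaRapoport2013, §2.4 Definition 2.18 (arXiv v2 p. 13)] -/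
def RelevantSharp.Iso {C : Sec2Core k} (P Q : C.RelevantSharp) : Prop :=
  ∃ e : P.V.V ≃ₗ[k] Q.V.V, (∀ x y : P.V.V, Q.V.form (e x) (e y) = P.V.form x y) ∧
    ∀ L'' : SelfDualLattice k Q.V, L''.carrier = P.L.carrier.map e.toAddMonoidHom → C.SameGenus L'' Q.L

/-- Strict similarity of pairs `(V, [[L]])`, `(V', [[L']])` («`R_{(n−r,r)}(k)^♯/str.sim.`», Prop. 2.19 (i) p. 14; the print does
not spell the relation out): READING — the spaces are strictly similar (★ `HermStrictSim`: form scaled by `c ∈ ℚ_{>0}`) AND the genera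
correspond, the genus being compared through its TYPE: «The `G₁^V`-genus is determined by its type, as defined in (ii) of the preceding
remark» (p. 13; in the proof of Prop. 2.19, p. 14, the summand is read off «the norm `μ(T₂(A))`», i.e. the type, which is insensitive to
the `ℤ₂^×`-scaling ambiguity of the form).  (A similarity with `c ≠ 1` does NOT carry self-dual lattices to self-dual lattices — the
image is `c`-modular — so the genus cannot be compared through the image lattice as in `RelevantSharp.Iso`; reviewer of p848160.)
[cite: KudlaRapoport2013, §2.4 Definition 2.18 and Proposition 2.19 (i) (arXiv v2 pp. 13–14)] -/
def RelevantSharp.StrictSim {C : Sec2Core k} (P Q : C.RelevantSharp) : Prop :=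
  HermStrictSim k P.V Q.V ∧ (IsTypeII k P.L ↔ IsTypeII k Q.L)

/-- Case (a) of Prop. 2.14 at the prime `p` for (the localization of) `V` (p. 12): «`p = 2`, `k/ℚ_p` is ramified, `n = dim V_p` is even
and `V_p` is a split space» — REAL arithmetic clauses, ⟨CARRIER⟩ «split». [cite: KudlaRapoport2013, §2.4 Proposition 2.14 (a) (arXiv v2 p. 12)] -/
def IsCaseA (V : HermSpace ℚ k) (p : ℕ) : Prop :=
  p = 2 ∧ IsRamifiedPrime k 2 ∧ Even V.n ∧ C.IsSplitAtTwo V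

/-- Case (b) of Prop. 2.14 at `p` (p. 12): «`p = 2`, `k = ℚ_p(√Δ)` where `ord₂(Δ) = 3`, `n = dim V_p` is even and `V_p` is the sum of a
`2`-dimensional anisotropic space and a split space of dimension `n − 2`». [cite: KudlaRapoport2013, §2.4 Proposition 2.14 (b) (arXiv v2 p. 12)] -/
def IsCaseB (V : HermSpace ℚ k) (p : ℕ) : Prop :=
  p = 2 ∧ padicValInt 2 (NumberField.discr k) = 3 ∧ Even V.n ∧ C.IsAnisoPlusSplitAtTwo V

/-- «`M(n−r,r)[½] = M(n−r,r) ×_{Spec O_k} Spec O_k[½]`, `M[½]`» (pp. 13–14): the base `S` lies over `Spec O_k[½]`, i.e. `2` is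
invertible in `Γ(S, 𝒪_S)`. REAL. [cite: KudlaRapoport2013, §2.4 (arXiv v2 pp. 13–14)] -/
def IsAwayFromTwo (S : Scheme.{0}) : Prop := IsUnit (2 : Γ(S, ⊤))

/-! ## The datum of §2, part 2: the OBJECT-DEPENDENT labels of Prop. 2.12 / 2.19 / 2.22 (`Sec2Data C`) -/

/-- **The datum of [KudlaRapoport2013] §2, part 2 (`Sec2Data C`)**: the ⟨CARRIER⟩ labels of the proof of Proposition 2.12 (pp. 11–12),
defined ON OBJECTS only (so that no carrier is total on non-objects) with inhabited codomains: «We claim that there is a unique element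
`V(ξ)` in `R_{(n−r,r)}(k)` which after tensoring with `𝔸_f` gives the hermitian space» of the Tate module of `ξ = (A, ι, λ)` … «The
space `V(ξ)` … depends on the choice of the geometric point `s` of `S`, on the complex embedding, and on the trivialization of the
group of roots of unity. A change in these choices changes the space `V(ξ)` within a strict similarity class», together with the
genus «of self-dual lattices in `V` determined by `T^p(A)`» (proof of Prop. 2.19, p. 14) — bundled as an element `(V(ξ), [[L]])` of
`R^♯`; and «the hermitian space `V = Hom_k(V(ξ₀), V(ξ))`» attached to a pair, «independent of all choices» (p. 12).  A consumer
supplies them for ITS objects. [cite: KudlaRapoport2013, §2.4 proof of Proposition 2.12 (arXiv v2 pp. 11–12)] -/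
structure Sec2Data (C : Sec2Core k) : Type 1 where
  /-- ⟨CARRIER⟩ `ξ = (A, ι, λ) ∈ M(n−r,r)(S) ↦ (V(ξ), [[L]]) ∈ R_{(n−r,r)}(k)^♯` (one representative of the strict similarity class). -/
  labelSharp : ∀ {S : Scheme.{0}} (f : S ⟶ Spec (.of (𝓞 k))), C.Obj f → C.RelevantSharp
  /-- ⟨CARRIER⟩ `((A, ι, λ), (E, ι₀, λ₀)) ∈ M(S) ↦ V = Hom_k(V(ξ₀), V(ξ))`, a hermitian space over `k`. -/
  pairLabel : ∀ {S : Scheme.{0}} (f : S ⟶ Spec (.of (𝓞 k))), C.MObj f → HermSpace ℚ k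

namespace Sec2Data

variable {C} (D : C.Sec2Data)

/-- `V(ξ)`, the hermitian-space component of the label (proof of Prop. 2.12, p. 11). [cite: KudlaRapoport2013, §2.4 proof of Proposition 2.12 (arXiv v2 p. 11)] -/
abbrev label {S : Scheme.{0}} (f : S ⟶ Spec (.of (𝓞 k))) (x : C.Obj f) : HermSpace ℚ k :=
  (D.labelSharp f x).V

end Sec2Data

end Sec2Core

end Literature.AlgebraicGeometry.ShimuraVarieties.KudlaRapoport2013.Sec2Defs

end
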